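/-
Copyright: the b2b-balaban T⁴-continuum CRUX team, row NE7b leaf lineage `t4-ne7b-formalise-leaf-05` (gen 155). Project licence.
-/
import Summits.QuantumFields.BalabanUV.T4Continuum.Spine.NE7b.LinearisedLatticeStokesDisc
import Summits.QuantumFields.BalabanUV.T4Continuum.Spine.NE7b.NonAbelianStokesRectScript

/-!
# THE LINEARISED LATTICE STOKES IDENTITY FOR THE COORDINATE RECTANGLE THROUGH ITS SCRIPT — junction of `LinearisedLatticeStokesDisc` (part III:
# scripts read in `N ⋊[φ] G`) with `NonAbelianStokesRectScript` (the rectangle's plaquette script): flat exactness with the COMB transports, the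
# curvature defect in part 1's plaquette-sum currency, and the stage budget of the rectangle script from ONE bond letter
# (row NE7b, node U5c; the (h1) slot of print's `γ₀` assembly — `HOME/b2b-balaban-r1/SectE-interface-proof.md` Lemma CS (i)–(ii))

Cell `pub-balaban`, sub-cell `t4`, spine estimate NE7b (`T4WeightBudget.RelWeightBound`; the cell's OWN estimate — NOT PRINTED in [Bałaban 1983–89],
NOT PROVED).  Crux-route work under `Spine/NE7b/` by a row leaf; [folklore]; NOTHING of Bałaban's named, asserted or valued; no `T4Continuum/Support`
leaf typed; no `def`; zero `sorry`.  Imports this lineage's `LinearisedLatticeStokesDisc` (p382171 ✓) and `NonAbelianStokesRectScript` ONLY.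

WHY.  `LinearisedLatticeStokesRectangle` (part II) proved the rectangle identity with ROW transports (`r_j · U([x, x+je_μ]) · U([x_j, x_j+ie_κ])`) by the
stack-of-ladders recursion.  `NonAbelianStokesRectScript` presents the same rectangle by a SCRIPT of leaf-01's `NonAbelianStokesDisc` (column after
column, plaquette after plaquette), and `LinearisedLatticeStokesDisc` reads any script in `N ⋊[φ] G`.  Composing the two BY NAME gives a second,
independent derivation with the COMB transports `U(κ^i · κ⁺ · μ^j · κ⁻)` — the lasso system of the script — and the curvature defect priced by the
SAME plaquette sum `Σ_{i<n} Σ_{j<K} dist1 U(∂p(x + ie_κ + je_μ))` that bounds `dist1 U(∂R)` in part 1; the stage budget is explicit in `n`, `K` and a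
bond letter `sz A(b) ≤ a`.

WHAT IS PROVED ([folklore]):
* §1 THE STAGES OF THE RECTANGLE SCRIPT: `stages_rectScript_zero`, **`stages_rectScript_succ`** (the new column's `K` stages: prefix `κ^n κ⁺ μ^j κ⁻`, loop
  `∂p_{κμ}`, entered word `κ^n (κ⁺ μ^j κ⁻ μ̄^j) μ^K κ̄^n μ̄^K`, `j = K−1, …, 0`), `length_le_of_mem_stages_rectScript` (`|α| ≤ n + K + 1`, `|w| ≤ 2n + 4K`).
* §2 **`left_hol_rectWord_of_flat_script`** — flat plaquettes ⟹ `(∂R_{n,K}).left = ∏_{stages} φ(U(α)) (∂p).left` EXACTLY (comb transports).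
* §3 **`sz_rectWord_script_defect_le`** — under the size letters and a stage budget `B`: `sz(∂R.left ∕ comb flat formula) ≤ c·B·Σ_{i<n}Σ_{j<K} dist1 U(∂p(x+ie_κ+je_μ))`;
  **`sz_rectWord_script_defect_le_of_bond_letter`** — with `sz 1 = 0`, `φ` `sz`-isometric and a bond letter `sz A(b) ≤ a` (`a ≥ 0`) the budget is
  `B = (3n + 5K + 1)·a`: defect `≤ c·(3n + 5K + 1)·a·Σ_{i<n}Σ_{j<K} dist1 U(∂p)`.
* §4 toy: the `1 × 1` rectangle — one stage `(κ⁺κ⁻, ∂p, κ⁺κ⁻μ⁺μ⁻)`.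

NOT HERE (honest): the comparison of the comb formula with part II's row formula (they differ by transports of flat sub-rectangles — equal under full
flatness, `O(ε_F)`-close in (5.2)'s regime: step (ii), (A3) territory); values of `ε_F`, `c_g`; which rectangles are Bałaban's (NC-NE7b-α UNRULED).
BY-NAME EFFECT ON THE WALL: NONE.  NE7b NOT PRINTED ∕ NOT PROVED; spine PROVED 0∕9; rung (B)+1 on a FINITE torus — NOT infinite volume, NOT the mass
gap, NOT Clay.  HONEST DEPENDENCY: continuum YM on T⁴ ⇐ BetaPertH ∧ nine spine estimates (0/9 proved); BetaPertH ⇐ (D1) ∧ (D4) ∧ CAP+tail; G-an2-4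
gates asym, D1 and NE2/3/4.
-/

set_option autoImplicit false

open scoped BigOperators

namespace Summit.QuantumFields.BalabanUV.T4Continuum.NE7b.LinearisedStokesRectScript

open Literature.MathematicalPhysics.QuantumFieldTheory.Balaban1983to89 (GaugeGroup dist1)
open Literature.MathematicalPhysics.QuantumFieldTheory.Balaban1983to89.B7Prop1Explicit
  (Site Letter e disp disp_append disp_replicate hol plaqWord disp_plaqWord)
open NonAbelianStokesBound (rectWord)
open NonAbelianStokesDisc
open LinearisedLatticeStokesDisc (stages stages_backtrack stages_cancel stages_loop left_hol_build_of_flat' sz_build_defect_le_plaquettes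
  sz_left_hol_le_length_mul)
open NonAbelianStokesRectScript

variable {d : ℕ}

/-! ## §1 The stages of the rectangle script -/

section Stages

/-- `rowBase` has no stage. -/
theorem stages_rowBase (μ : Fin d) : ∀ K : ℕ, stages (rowBase μ K) = ([] : List (List (Letter d) × List (Letter d) × List (Letter d)))
  | 0 => rfl
  | K + 1 => by rw [rowBase, stages_backtrack, stages_rowBase μ K]

/-- `rowCancels` adds no stage. -/
theorem stages_rowCancels_append (μ : Fin d) (base : ℕ) (rest : List (Move d)) :
    ∀ m t : ℕ, stages (rowCancels μ base t m ++ rest) = stages rest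
  | 0, t => by rw [rowCancels, List.nil_append]
  | m + 1, t => by rw [rowCancels, List.cons_append, stages_cancel, stages_rowCancels_append μ base rest m (t + 1)]

/-- THE COLUMN PHASE'S STAGES: prefix `pre ++ κ⁺ μ^i κ⁻`, loop `∂p_{κμ}`, entered word `pre ++ κ⁺ μ^i κ⁻ μ̄^i ++ suf`, `i = j−1, …, 0`. [folklore] -/
theorem stages_colMoves_append (κ μ : Fin d) {n : ℕ} (pre suf : List (Letter d)) (hpre : pre.length = n) (rest : List (Move d))
    (hrest : build rest = pre ++ ((κ, true) :: (κ, false) :: suf)) : ∀ j : ℕ,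
    stages (colMoves κ μ n j ++ rest) =
      ((List.range j).reverse.map fun i : ℕ =>
        (pre ++ ((κ, true) :: (List.replicate i ((μ, true) : Letter d) ++ [(κ, false)])), plaqWord κ μ,
          pre ++ ((κ, true) :: (List.replicate i ((μ, true) : Letter d) ++ (κ, false) :: (List.replicate i ((μ, false) : Letter d) ++ suf)))))
        ++ stages rest
  | 0 => by rw [colMoves, List.nil_append, List.range_zero, List.reverse_nil, List.map_nil, List.nil_append]
  | j + 1 => by
    have ih := stages_colMoves_append κ μ pre suf hpre rest hrest j
    have hb := build_colMoves κ μ pre suf hpre rest hrest j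
    have hA : (pre ++ ((κ, true) :: (List.replicate j ((μ, true) : Letter d) ++ [(κ, false)]))).length = n + j + 2 := by
      simp [hpre]; omega
    have htake : (build (colMoves κ μ n j ++ rest)).take (n + j + 2) =
        pre ++ ((κ, true) :: (List.replicate j ((μ, true) : Letter d) ++ [(κ, false)])) := by
      rw [hb, show pre ++ ((κ, true) :: (List.replicate j ((μ, true) : Letter d) ++ (κ, false) :: (List.replicate j ((μ, false) : Letter d) ++ suf)))
        = (pre ++ ((κ, true) :: (List.replicate j ((μ, true) : Letter d) ++ [(κ, false)]))) ++ (List.replicate j ((μ, false) : Letter d) ++ suf) by simp]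
      exact List.take_left' hA
    rw [colMoves, List.cons_append, List.cons_append, stages_cancel, stages_loop, ih, htake, hb, List.range_succ, List.reverse_append,
      List.reverse_singleton, List.singleton_append, List.map_cons, List.cons_append]

/-- `stages` of the height-`0` script. -/
theorem stages_rectScript_zero (κ μ : Fin d) (K : ℕ) :
    stages (rectScript κ μ K 0) = ([] : List (List (Letter d) × List (Letter d) × List (Letter d))) := by
  rw [rectScript, stages_rowBase]

/-- **THE STAGES, ONE COLUMN AT A TIME**: passing from `n` to `n + 1` prepends the `K` stages of column `n` —
prefix `κ^n κ⁺ μ^j κ⁻` (the comb to the corner `x + ne_κ + je_μ` and back down one bond), loop `∂p_{κμ}`, entered word `κ^n κ⁺ μ^j κ⁻ μ̄^j μ^K κ̄^n μ̄^K`. [folklore] -/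
theorem stages_rectScript_succ (κ μ : Fin d) (K n : ℕ) :
    stages (rectScript κ μ K (n + 1)) =
      ((List.range K).reverse.map fun j : ℕ =>
        (List.replicate n ((κ, true) : Letter d) ++ ((κ, true) :: (List.replicate j ((μ, true) : Letter d) ++ [(κ, false)])), plaqWord κ μ,
          List.replicate n ((κ, true) : Letter d) ++ ((κ, true) :: (List.replicate j ((μ, true) : Letter d) ++ (κ, false) ::
            (List.replicate j ((μ, false) : Letter d) ++ (List.replicate K ((μ, true) : Letter d) ++
              (List.replicate n ((κ, false) : Letter d) ++ List.replicate K ((μ, false) : Letter d))))))))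
        ++ stages (rectScript κ μ K n) := by
  have h1 : build (Move.backtrack n (κ, true) :: rectScript κ μ K n) =
      List.replicate n ((κ, true) : Letter d) ++ ((κ, true) :: (κ, false) ::
        (List.replicate K ((μ, true) : Letter d) ++ (List.replicate n ((κ, false) : Letter d) ++ List.replicate K ((μ, false) : Letter d)))) := by
    rw [build, build_rectScript_replicate, apply_backtrack_of_length _ _ _ (List.length_replicate ..)]
    rfl
  rw [rectScript, stages_rowCancels_append, stages_colMoves_append κ μ (List.replicate n ((κ, true) : Letter d)) _ (List.length_replicate ..) _ h1 K,
    stages_backtrack]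

/-- **STAGE LENGTHS**: every stage `(α, σ, w)` of `rectScript κ μ K n` has `|α| ≤ n + K + 1` and `|w| ≤ 2n + 4K`. [folklore] -/
theorem length_le_of_mem_stages_rectScript (κ μ : Fin d) (K : ℕ) : ∀ (n : ℕ) (t : List (Letter d) × List (Letter d) × List (Letter d)),
    t ∈ stages (rectScript κ μ K n) → t.1.length ≤ n + K + 1 ∧ t.2.2.length ≤ 2 * n + 4 * K
  | 0, t, ht => by rw [stages_rectScript_zero] at ht; simp at ht
  | n + 1, t, ht => by
    rw [stages_rectScript_succ, List.mem_append] at ht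
    rcases ht with ht | ht
    · obtain ⟨j, hj, rfl⟩ := List.mem_map.mp ht
      have hjK : j < K := by simpa using hj
      constructor
      · simp; omega
      · simp; omega
    · have ih := length_le_of_mem_stages_rectScript κ μ K n t ht
      constructor <;> omega

end Stages

/-! ## §2 Flat exactness for the rectangle through its script -/

section Flat

variable {G N : Type*} [Group G] [CommGroup N] {φ : G →* MulAut N}
variable (W : Site d → Fin d → N ⋊[φ] G) (U : Site d → Fin d → G)

/-- **FLAT EXACTNESS WITH THE COMB TRANSPORTS.**  If every plaquette glued by the rectangle script is flat, `U(∂p(x + ie_κ + je_μ)) = 1`, then the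
`N`-part of the rectangle's pair holonomy is EXACTLY `∏_{stages} φ(U(κ^i κ⁺ μ^j κ⁻)) (∂p).left` (`LinearisedLatticeStokesDisc.left_hol_build_of_flat'`
∘ `NonAbelianStokesRectScript.build_rectScript`). [folklore] -/
theorem left_hol_rectWord_of_flat_script (hU : ∀ y k, (W y k).right = U y k) (x : Site d) (κ μ : Fin d) (n K : ℕ)
    (hflat : ∀ q ∈ glued x (rectScript κ μ K n), hol U q.1 q.2 = 1) :
    (hol W x (rectWord κ μ n K)).left =
      ((stages (rectScript κ μ K n)).map fun t => φ (hol U x t.1) (hol W (x + disp t.1) t.2.1).left).prod := by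
  rw [← build_rectScript]
  exact left_hol_build_of_flat' W U hU x _ (fun σ hσ => by rw [eq_plaqWord_of_mem_loops_rectScript κ μ K n hσ, disp_plaqWord]) hflat

end Flat

/-! ## §3 The curvature defect in the plaquette-sum currency, and the explicit budget -/

section Defect

variable {G N : Type*} [GaugeGroup G] [CommGroup N] {φ : G →* MulAut N}
variable (W : Site d → Fin d → N ⋊[φ] G) (U : Site d → Fin d → G)

/-- Every glued word of a script is one of its inserted words. [folklore] -/
theorem snd_mem_loops_of_mem_glued (x : Site d) : ∀ (ms : List (Move d)) (q : (Site d) × List (Letter d)), q ∈ glued x ms → q.2 ∈ loops ms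
  | [], q, hq => by simp [glued] at hq
  | Move.backtrack k l :: ms, q, hq => by
    rw [glued] at hq; rw [loops]; exact snd_mem_loops_of_mem_glued x ms q hq
  | Move.cancel k l :: ms, q, hq => by
    rw [glued] at hq; rw [loops]; exact snd_mem_loops_of_mem_glued x ms q hq
  | Move.loop k τ :: ms, q, hq => by
    rw [glued] at hq; rw [loops]
    rcases List.mem_cons.mp hq with rfl | hq
    · exact List.mem_cons_self
    · exact List.mem_cons_of_mem _ (snd_mem_loops_of_mem_glued x ms q hq)

/-- **THE DEFECT FOR THE RECTANGLE THROUGH ITS SCRIPT**, in part 1's plaquette-sum currency: under the size letters of `LinearisedLatticeStokes` §3 and a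
stage budget `B`, `sz(∂R.left ∕ comb flat formula) ≤ c · B · Σ_{i<n} Σ_{j<K} dist1 U(∂p(x + ie_κ + je_μ))`. [folklore] -/
theorem sz_rectWord_script_defect_le (hU : ∀ y k, (W y k).right = U y k) (sz : N → ℝ) {c B : ℝ} (hc : 0 ≤ c)
    (h0 : ∀ a, 0 ≤ sz a) (hmul : ∀ a b, sz (a * b) ≤ sz a + sz b) (hinv : ∀ a, sz a⁻¹ = sz a)
    (hdef : ∀ (g : G) (a : N), sz (φ g a * a⁻¹) ≤ c * dist1 g * sz a) (x : Site d) (κ μ : Fin d) (n K : ℕ)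
    (hB : ∀ t ∈ stages (rectScript κ μ K n), sz (hol W x t.1).left + sz (hol W x t.2.2).left ≤ B) :
    sz ((hol W x (rectWord κ μ n K)).left *
        (((stages (rectScript κ μ K n)).map fun t => φ (hol U x t.1) (hol W (x + disp t.1) t.2.1).left).prod)⁻¹)
      ≤ c * B * ∑ i ∈ Finset.range n, ∑ j ∈ Finset.range K, dist1 (hol U (x + (i : ℤ) • e κ + (j : ℤ) • e μ) (plaqWord κ μ)) := by
  rw [← build_rectScript, ← sum_glued_rectScript κ μ x K (fun q => dist1 (hol U q.1 (plaqWord κ μ))) n]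
  exact sz_build_defect_le_plaquettes W U hU sz hc h0 hmul hinv hdef x _ (fun _ => (κ, μ))
    (fun q hq => Or.inl (eq_plaqWord_of_mem_loops_rectScript κ μ K n (snd_mem_loops_of_mem_glued x _ q hq))) hB

/-- **THE DEFECT FROM ONE BOND LETTER.**  With `sz 1 = 0`, `φ` `sz`-isometric and `sz A(b) ≤ a` on every bond (`0 ≤ a`), the stage budget of the rectangle
script is `B = (3n + 5K + 1)·a` (`|α| ≤ n + K + 1`, `|w| ≤ 2n + 4K`, `LinearisedLatticeStokesDisc.sz_left_hol_le_length_mul`):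
`sz(∂R.left ∕ comb flat formula) ≤ c·(3n + 5K + 1)·a·Σ_{i<n}Σ_{j<K} dist1 U(∂p)`. [folklore] -/
theorem sz_rectWord_script_defect_le_of_bond_letter (hU : ∀ y k, (W y k).right = U y k) (sz : N → ℝ) {c a : ℝ} (hc : 0 ≤ c) (ha : 0 ≤ a)
    (h0 : ∀ b, 0 ≤ sz b) (h1 : sz 1 = 0) (hmul : ∀ b b', sz (b * b') ≤ sz b + sz b') (hinv : ∀ b, sz b⁻¹ = sz b)
    (hiso : ∀ (g : G) (b : N), sz (φ g b) = sz b) (hdef : ∀ (g : G) (b : N), sz (φ g b * b⁻¹) ≤ c * dist1 g * sz b)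
    (hbond : ∀ y k, sz (W y k).left ≤ a) (x : Site d) (κ μ : Fin d) (n K : ℕ) :
    sz ((hol W x (rectWord κ μ n K)).left *
        (((stages (rectScript κ μ K n)).map fun t => φ (hol U x t.1) (hol W (x + disp t.1) t.2.1).left).prod)⁻¹)
      ≤ c * ((3 * n + 5 * K + 1 : ℕ) * a) *
          ∑ i ∈ Finset.range n, ∑ j ∈ Finset.range K, dist1 (hol U (x + (i : ℤ) • e κ + (j : ℤ) • e μ) (plaqWord κ μ)) := by
  refine sz_rectWord_script_defect_le W U hU sz hc h0 hmul hinv hdef x κ μ n K fun t ht => ?_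
  obtain ⟨h1', h2'⟩ := length_le_of_mem_stages_rectScript κ μ K n t ht
  have e1 := sz_left_hol_le_length_mul W sz h1 hmul hinv hiso hbond x t.1
  have e2 := sz_left_hol_le_length_mul W sz h1 hmul hinv hiso hbond x t.2.2
  have h3 : (t.1.length : ℝ) * a ≤ (n + K + 1 : ℕ) * a := mul_le_mul_of_nonneg_right (by exact_mod_cast h1') ha
  have h4 : (t.2.2.length : ℝ) * a ≤ (2 * n + 4 * K : ℕ) * a := mul_le_mul_of_nonneg_right (by exact_mod_cast h2') ha
  calc sz (hol W x t.1).left + sz (hol W x t.2.2).left ≤ (n + K + 1 : ℕ) * a + (2 * n + 4 * K : ℕ) * a := by linarith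
    _ = (3 * n + 5 * K + 1 : ℕ) * a := by push_cast; ring

end Defect

/-! ## §4 Toy -/

/-- The `1 × 1` rectangle script has exactly ONE stage: prefix `κ^0 κ⁺ μ^0 κ⁻ = κ⁺κ⁻` (the comb to the corner `x` and back down one bond — a lasso tail
of trivial transport `U(x,κ)U(x,κ)⁻¹ = 1`), loop `∂p_{κμ}`, entered word `κ⁺ κ⁻ μ⁺ μ⁻` (the `1 × 1` word with the backtrack still in). -/
example (κ μ : Fin d) :
    stages (rectScript κ μ 1 1) = [([((κ, true) : Letter d), (κ, false)], plaqWord κ μ, [((κ, true) : Letter d), (κ, false), (μ, true), (μ, false)])] := by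
  rw [stages_rectScript_succ, stages_rectScript_zero]; simp

end Summit.QuantumFields.BalabanUV.T4Continuum.NE7b.LinearisedStokesRectScript
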